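import Literature.Analysis.FluidPDE.TorusBKMGradientLogBound
import Literature.Analysis.FluidPDE.TorusLinearisedNSVorticity
import Literature.Analysis.FunctionSpaces.TorusPlanarLift
import HarnessLib

/-!
# The Beale–Kato–Majda logarithmic gradient bound on the two-torus `T²`, by planar lift

Analysis/FluidPDE proof file (theorems only, no definitions, no named facts). The planar case of the
tree's periodic Beale–Kato–Majda potential-theory estimate `Torus.exists_sqrt_gradSq_le_bkm_log`
(`TorusBKMGradientLogBound.lean`; Doering–Gibbon 1995, Thm. 7.5 "valid for the periodic domain
`[0, L]^N`", `N = 2, 3`; Beale–Kato–Majda 1984 (13)–(15); Majda–Bertozzi 2002 Prop. 3.8,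
(3.83)–(3.87)): for a smooth divergence-free `w : T² → ℝ²` with scalar vorticity
`ω = ∂₀w₁ − ∂₁w₀` (`torusVorticityTensor w 0 1`) bounded by `Ω` and every `0 < δ ≤ 1`, at every point

`|∇w(y)|_F ≤ C ( (‖∇Δw‖₂ + Ω) δ^{1/2} + Ω log(1/δ) + ‖w‖₂ )`

(`Torus.exists_sqrt_gradSq_le_bkm_log_fin_two`), and the optimised form

`|∇w(y)|_F ≤ C ( Ω (1 + log(1 + ‖∇Δw‖₂/Ω)) + ‖w‖₂ )`  (`Ω > 0`)

(`Torus.exists_sqrt_gradSq_le_bkm_log_homogeneous_fin_two`). The proof is a reduction, not a new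
potential-theory estimate: the `2½`-dimensional lift `W = (w ∘ π, 0)` of `w` to `T³`
(`Torus.twoHalf w 0`, `TorusPlanarLift`) is smooth and divergence free, does not depend on `x₂`, has
`|curl W(x)|² = ω(πx)²`, `|∇W(x)|_F = |∇w(πx)|_F`, `‖∇ΔW‖_{L²(T³)} = ‖∇Δw‖_{L²(T²)}` and
`‖W‖_{L²(T³)} = ‖w‖_{L²(T²)}` (the planar projection preserves volume), so the `T³` estimate at any
point above `y` is the `T²` estimate at `y`, with the same absolute constant. The planar statement is
the one printed by Doering–Gibbon for `N = 2` (their `κ_{2,r}`).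

Reading (cell `ad-ideate`, route SawtoothPulseCascade, K2Lip): together with the vorticity maximum
principle for the planar linearised response (`TorusLinearisedNSVorticity`,
`SawtoothCascadeResponseVorticity`, `SawtoothCascadeProfileCurvature`) this is the Biot–Savart step
from `sup|ω_w|` to the Lipschitz norm `sup|∇w|`, at the price of `log(‖∇Δw‖₂/sup|ω_w|)`.

* `Torus.torusVorticitySqAt_twoHalf_zero` — `|curl (w∘π, 0)|²(x) = ω(πx)²`;
* `Torus.sum_norm_sq_partialDeriv_twoHalf_zero` — `|∇(w∘π, 0)|_F² (x) = |∇w|_F²(πx)`;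
* `Torus.gradNormSq_laplacian_twoHalf_zero`, `Torus.integral_norm_sq_twoHalf_zero` — the two `L²`
  quantities agree;
* `Torus.exists_sqrt_gradSq_le_bkm_log_fin_two`, `Torus.exists_sqrt_gradSq_le_bkm_log_homogeneous_fin_two`.

## Mathlib / tree search

Tree (all used): `Torus.exists_sqrt_gradSq_le_bkm_log(_homogeneous)` (`TorusBKMGradientLogBound`, `T³`),
`Torus.twoHalf`, `Torus.partialDeriv_twoHalf_castSucc/_last`, `Torus.laplacian_twoHalf`,
`Torus.norm_sq_twoHalf`, `Torus.IsSmooth.twoHalf`, `Torus.IsDivFree.twoHalf`, `Torus.integral_comp_planarProj`,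
`Torus.planarProj` (`TorusPlanarLift`), `torusVorticitySqAt`, `torusVorticityTensor`,
`Torus.torusVorticitySqAt_fin_two` (`TorusLinearisedNSVorticity`). Searched
`bkm.*fin_two|Fin 2.*bkm|BrezisGallouet`: no planar BKM/Brezis–Gallouët bound in the tree
(LIT-PACK §25b of the cell recorded the gap).

## References

* C. R. Doering, J. D. Gibbon, *Applied Analysis of the Navier–Stokes Equations*, CUP 1995, §7.5,
  Thm. 7.5 (periodic domain `[0, L]^N`). [DoeringGibbon1995]
* J. T. Beale, T. Kato, A. Majda, Comm. Math. Phys. 94 (1984) 61–66, (13)–(15). [BealeKatoMajda1984]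
* A. J. Majda, A. L. Bertozzi, *Vorticity and Incompressible Flow*, CUP 2002, §3.3 Prop. 3.8,
  (3.83)–(3.87). [MajdaBertozzi2002]
-/

noncomputable section

open MeasureTheory Set Function Filter
open scoped NNReal ENNReal ContDiff

namespace Literature.Analysis.FunctionSpaces

namespace Torus

open Literature.Analysis.FluidPDE

/-! ### Part 1. The `2½`-dimensional lift `(w ∘ π, 0)` of a planar field -/

section Lift

variable {w : UnitAddTorus (Fin 2) → EuclideanSpace ℝ (Fin 2)}

/-- Partial derivatives of the zero scalar vanish. [folklore] -/
private theorem partialDeriv_zero_scalar (j : Fin 2) :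
    partialDeriv j (fun _ : UnitAddTorus (Fin 2) => (0 : ℝ)) = fun _ => 0 := by
  funext y
  simp [partialDeriv, Torus.lineDeriv]

/-- The Laplacian of the zero scalar vanishes. [folklore] -/
private theorem laplacian_zero_scalar :
    laplacian (fun _ : UnitAddTorus (Fin 2) => (0 : ℝ)) = fun _ => 0 := by
  funext y
  rw [laplacian_eq_sum_partialDeriv_partialDeriv (isSmooth_const (0 : ℝ)) y]
  simp [partialDeriv_zero_scalar]

/-- The zero scalar is `C¹`. [folklore] -/
private theorem isContDiff_zero_scalar : IsContDiff 1 (fun _ : UnitAddTorus (Fin 2) => (0 : ℝ)) :=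
  (isSmooth_const (0 : ℝ)).isContDiff (by simp)

/-- Planar partial derivatives of the lift: `∂_{j} (w∘π, 0) = (∂ⱼw ∘ π, 0)` (`j < 2`, `C¹` data). [folklore] -/
private theorem partialDeriv_twoHalf_zero_castSucc (hw : IsContDiff 1 w) (j : Fin 2) :
    partialDeriv (Fin.castSucc j) (twoHalf w 0) = twoHalf (partialDeriv j w) 0 := by
  have h := partialDeriv_twoHalf_castSucc hw isContDiff_zero_scalar j
  rw [partialDeriv_zero_scalar] at h
  exact h

/-- The vertical component of every planar partial derivative of the lift vanishes, and so does the
vertical derivative. [folklore] -/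
private theorem partialDeriv_twoHalf_zero_apply_two (hw : IsContDiff 1 w) (i : Fin 3) (x : UnitAddTorus (Fin 3)) :
    partialDeriv i (twoHalf w 0) x 2 = 0 := by
  induction i using Fin.lastCases with
  | last => rw [partialDeriv_twoHalf_last]; rfl
  | cast j => rw [partialDeriv_twoHalf_zero_castSucc hw j, ← last_two_eq,
      show (Fin.last 2 : Fin 3) = 2 from rfl, twoHalf_apply_two]; rfl

/-- **`|curl (w∘π, 0)|² = ω(π x)²`**: the orientation-free vorticity square of the lift of a planar
`C¹` field is the square of the planar scalar vorticity `ω = ∂₀w₁ − ∂₁w₀` (Majda–Bertozzi 2002,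
§2.1: for 2D flows `ω = (0, 0, v²_{x₁} − v¹_{x₂})`). [cite: MajdaBertozziCUP2002, §2.1 eqs. (2.5)–(2.6)] -/
theorem torusVorticitySqAt_twoHalf_zero (hw : IsContDiff 1 w) (x : UnitAddTorus (Fin 3)) :
    torusVorticitySqAt (twoHalf w 0) x = torusVorticityTensor w 0 1 (planarProj x) ^ 2 := by
  rw [← Literature.Analysis.FluidPDE.Torus.torusVorticitySqAt_fin_two]
  unfold torusVorticitySqAt
  congr 1
  -- split both sums into planar indices and the vertical one
  rw [Fin.sum_univ_castSucc]
  have hlast : ∀ j : Fin 3, (partialDeriv (Fin.last 2) (twoHalf w 0) x j -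
      partialDeriv j (twoHalf w 0) x (Fin.last 2)) ^ 2 = 0 := by
    intro j
    rw [partialDeriv_twoHalf_last, show (Fin.last 2 : Fin 3) = 2 from rfl,
      partialDeriv_twoHalf_zero_apply_two hw]
    simp
  rw [Finset.sum_eq_zero (fun j _ => hlast j), add_zero]
  refine Finset.sum_congr rfl fun i _ => ?_
  rw [Fin.sum_univ_castSucc]
  have hcross : (partialDeriv (Fin.castSucc i) (twoHalf w 0) x (Fin.last 2) -
      partialDeriv (Fin.last 2) (twoHalf w 0) x (Fin.castSucc i)) ^ 2 = 0 := by
    rw [partialDeriv_twoHalf_last, show (Fin.last 2 : Fin 3) = 2 from rfl,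
      partialDeriv_twoHalf_zero_apply_two hw]
    simp
  rw [hcross, add_zero]
  refine Finset.sum_congr rfl fun j _ => ?_
  rw [partialDeriv_twoHalf_zero_castSucc hw i, partialDeriv_twoHalf_zero_castSucc hw j,
    twoHalf_apply_castSucc, twoHalf_apply_castSucc]

/-- **`|∇(w∘π, 0)|_F²(x) = |∇w|_F²(πx)`** for `C¹` planar `w` (a `2½`-dimensional field does not
depend on the vertical coordinate, Majda–Bertozzi 2002 §2.3.1). [cite: MajdaBertozziCUP2002, §2.3.1 Prop. 2.7] -/
theorem sum_norm_sq_partialDeriv_twoHalf_zero (hw : IsContDiff 1 w) (x : UnitAddTorus (Fin 3)) :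
    ∑ i, ‖partialDeriv i (twoHalf w 0) x‖ ^ 2 = ∑ j, ‖partialDeriv j w (planarProj x)‖ ^ 2 := by
  rw [Fin.sum_univ_castSucc, partialDeriv_twoHalf_last, Pi.zero_apply, norm_zero,
    zero_pow two_ne_zero, add_zero]
  refine Finset.sum_congr rfl fun j _ => ?_
  rw [partialDeriv_twoHalf_zero_castSucc hw j, norm_sq_twoHalf]
  simp

/-- The lift has the planar field's `L²` mass: `∫_{T³} ‖(w∘π, 0)‖² = ∫_{T²} ‖w‖²` (continuous `w`;
Majda–Bertozzi 2002 §2.3.1, the `2½`-dimensional ansatz on the period cell). [cite: MajdaBertozziCUP2002, §2.3.1 Prop. 2.7] -/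
theorem integral_norm_sq_twoHalf_zero (hw : Continuous w) :
    ∫ x, ‖twoHalf w 0 x‖ ^ 2 = ∫ y, ‖w y‖ ^ 2 := by
  have h : (fun x => ‖twoHalf w 0 x‖ ^ 2) = fun x => (fun y => ‖w y‖ ^ 2) (planarProj x) := by
    funext x
    rw [norm_sq_twoHalf]
    simp
  rw [h]
  exact integral_comp_planarProj (hw.norm.pow 2).aestronglyMeasurable

/-- `‖∇Δ(w∘π, 0)‖_{L²(T³)}² = ‖∇Δw‖_{L²(T²)}²` for smooth planar `w` (the lift commutes with `Δ` and
`∇`, Majda–Bertozzi 2002 §2.3.1). [cite: MajdaBertozziCUP2002, §2.3.1 Prop. 2.7] -/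
theorem gradNormSq_laplacian_twoHalf_zero (hw : IsSmooth w) :
    gradNormSq (laplacian (twoHalf w 0)) = gradNormSq (laplacian w) := by
  have hΔ : laplacian (twoHalf w 0) = twoHalf (laplacian w) 0 := by
    have h := laplacian_twoHalf hw (isSmooth_const (0 : ℝ))
    rw [laplacian_zero_scalar] at h
    exact h
  rw [hΔ, gradNormSq, gradNormSq]
  have hΔw : IsContDiff 1 (laplacian w) := hw.laplacian.isContDiff (by simp)
  have h : (fun x => ∑ i, ‖partialDeriv i (twoHalf (laplacian w) 0) x‖ ^ 2) =
      fun x => (fun y => ∑ j, ‖partialDeriv j (laplacian w) y‖ ^ 2) (planarProj x) := by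
    funext x
    exact sum_norm_sq_partialDeriv_twoHalf_zero hΔw x
  rw [h]
  exact integral_comp_planarProj (continuous_finsetSum _ fun j _ =>
    ((hw.laplacian.partialDeriv j).continuous.norm.pow 2)).aestronglyMeasurable

/-- A point of `T³` above `y ∈ T²`. [folklore] -/
private theorem planarProj_lastCases (y : UnitAddTorus (Fin 2)) :
    planarProj (Fin.lastCases (motive := fun _ => UnitAddCircle) (0 : UnitAddCircle) y : UnitAddTorus (Fin 3)) = y := by
  funext j
  rw [planarProj_apply, Fin.lastCases_castSucc]

end Lift

/-! ### Part 2. The planar Beale–Kato–Majda bound -/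

/-- **Beale–Kato–Majda logarithmic gradient bound on `T²`, `δ`-form** (Doering–Gibbon 1995, Thm. 7.5
with `N = 2`; Majda–Bertozzi 2002 (3.87) in the periodic setting): there is an absolute `C > 0` such that
for every smooth divergence-free `w : T² → ℝ²`, every `Ω ≥ 0` with `|∂₀w₁ − ∂₁w₀| ≤ Ω` pointwise, every
`0 < δ ≤ 1` and every `y`,
`|∇w(y)|_F ≤ C ( (‖∇Δw‖₂ + Ω) δ^{1/2} + Ω log(1/δ) + ‖w‖₂ )`,
`|∇w(y)|_F = (∑ⱼ ‖∂ⱼw(y)‖²)^{1/2}`, `‖∇Δw‖₂² = Torus.gradNormSq (Δw)`. Reduction to the tree's `T³`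
theorem through the lift `(w∘π, 0)`. [cite: DoeringGibbon1995, §7.5 Thm. 7.5] -/
theorem exists_sqrt_gradSq_le_bkm_log_fin_two :
    ∃ C : ℝ, 0 < C ∧ ∀ (w : UnitAddTorus (Fin 2) → EuclideanSpace ℝ (Fin 2)), IsSmooth w → IsDivFree w →
      ∀ Ω : ℝ, 0 ≤ Ω → (∀ y, |torusVorticityTensor w 0 1 y| ≤ Ω) →
      ∀ δ : ℝ, 0 < δ → δ ≤ 1 → ∀ y : UnitAddTorus (Fin 2),
        Real.sqrt (∑ j, ‖partialDeriv j w y‖ ^ 2) ≤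
          C * ((Real.sqrt (gradNormSq (laplacian w)) + Ω) * δ ^ (1 / 2 : ℝ) +
            Ω * Real.log (1 / δ) + Real.sqrt (∫ z, ‖w z‖ ^ 2)) := by
  obtain ⟨C, hC, h3⟩ := exists_sqrt_gradSq_le_bkm_log
  refine ⟨C, hC, fun w hw hdiv Ω hΩ0 hΩ δ hδ hδ1 y => ?_⟩
  have hw1 : IsContDiff 1 w := hw.isContDiff (by simp)
  set W : UnitAddTorus (Fin 3) → EuclideanSpace ℝ (Fin 3) := twoHalf w 0 with hW
  have hWs : IsSmooth W := hw.twoHalf (isSmooth_const (0 : ℝ))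
  have hWdiv : IsDivFree W := hdiv.twoHalf 0
  have hWΩ : ∀ x, torusVorticitySqAt W x ≤ Ω ^ 2 := by
    intro x
    rw [hW, torusVorticitySqAt_twoHalf_zero hw1 x, ← sq_abs]
    exact pow_le_pow_left₀ (abs_nonneg _) (hΩ _) 2
  set x : UnitAddTorus (Fin 3) := Fin.lastCases (motive := fun _ => UnitAddCircle) (0 : UnitAddCircle) y with hx
  have hπ : planarProj x = y := planarProj_lastCases y
  have key := h3 W hWs hWdiv Ω hΩ0 hWΩ δ hδ hδ1 x
  rw [hW, sum_norm_sq_partialDeriv_twoHalf_zero hw1 x, gradNormSq_laplacian_twoHalf_zero hw,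
    integral_norm_sq_twoHalf_zero hw.continuous, hπ] at key
  exact key

/-- **Beale–Kato–Majda logarithmic gradient bound on `T²`, optimised form** (Beale–Kato–Majda (15) /
Majda–Bertozzi (3.83) in the periodic planar setting; Doering–Gibbon Thm. 7.5, `N = 2`): for `Ω > 0`
with `|∂₀w₁ − ∂₁w₀| ≤ Ω`,
`|∇w(y)|_F ≤ C ( Ω (1 + log(1 + ‖∇Δw‖₂/Ω)) + ‖w‖₂ )`. [cite: DoeringGibbon1995, §7.5 Thm. 7.5] -/
theorem exists_sqrt_gradSq_le_bkm_log_homogeneous_fin_two :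
    ∃ C : ℝ, 0 < C ∧ ∀ (w : UnitAddTorus (Fin 2) → EuclideanSpace ℝ (Fin 2)), IsSmooth w → IsDivFree w →
      ∀ Ω : ℝ, 0 < Ω → (∀ y, |torusVorticityTensor w 0 1 y| ≤ Ω) → ∀ y : UnitAddTorus (Fin 2),
        Real.sqrt (∑ j, ‖partialDeriv j w y‖ ^ 2) ≤
          C * (Ω * (1 + Real.log (1 + Real.sqrt (gradNormSq (laplacian w)) / Ω)) +
            Real.sqrt (∫ z, ‖w z‖ ^ 2)) := by
  obtain ⟨C, hC, h3⟩ := exists_sqrt_gradSq_le_bkm_log_homogeneous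
  refine ⟨C, hC, fun w hw hdiv Ω hΩ hΩb y => ?_⟩
  have hw1 : IsContDiff 1 w := hw.isContDiff (by simp)
  set W : UnitAddTorus (Fin 3) → EuclideanSpace ℝ (Fin 3) := twoHalf w 0 with hW
  have hWs : IsSmooth W := hw.twoHalf (isSmooth_const (0 : ℝ))
  have hWdiv : IsDivFree W := hdiv.twoHalf 0
  have hWΩ : ∀ x, torusVorticitySqAt W x ≤ Ω ^ 2 := by
    intro x
    rw [hW, torusVorticitySqAt_twoHalf_zero hw1 x, ← sq_abs]
    exact pow_le_pow_left₀ (abs_nonneg _) (hΩb _) 2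
  set x : UnitAddTorus (Fin 3) := Fin.lastCases (motive := fun _ => UnitAddCircle) (0 : UnitAddCircle) y with hx
  have hπ : planarProj x = y := planarProj_lastCases y
  have key := h3 W hWs hWdiv Ω hΩ hWΩ x
  rw [hW, sum_norm_sq_partialDeriv_twoHalf_zero hw1 x, gradNormSq_laplacian_twoHalf_zero hw,
    integral_norm_sq_twoHalf_zero hw.continuous, hπ] at key
  exact key

end Torus

end Literature.Analysis.FunctionSpaces

end
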